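import Summits.ABC.IUTFork.Repair.RHHeightScalingR4RayFaces
import HarnessLib

/-!
# R-H ROUND 4, row R4OBJ-FACES — THE TYPED CLASS PROPS DECIDED ON THE KERNEL (part 3): CLASS (v) «HEIGHT × LEVEL DIAGONAL» (census row of
# abc-iut-rh2-L1's R4OBJ-DIAG): `Diag_NegExponent`, `¬ Diag_Door`, `Diag_RequirementPositiveFraction` — PROVED, via the generic ray face with a
# SUB-LINEAR POWER ceiling `Π(n) ≤ A·n^γ`, `γ < 1` (PROOF-ONLY, 0 definitions)

abc-iut cell, rung LADDER-ABC:A2.RESCUE.H, ROUND 4 (HUMAN D-0133 · D-0134 · D-0135; KEY `wake/KEY-abc-iut-rh2-w-2-R4OBJ-FACES.md`, abc-iut-rh-lead g5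
2026-08-27T13:46:57Z; referee rh-ref-2). Seat abc-iut-rh2-w-2. Sequel of `Repair/RHHeightScalingR4RayFaces.lean` (p541729: `nettingKept_le_div`, `ray_negExponent`)
and `…DegMultiL` (part 2). THE PROPS are abc-iut-rh2-T-1's `Repair/RHHeightScalingR4Classes.lean` §5 (`diagRay`, `Diag_NegExponent`, `Diag_Door`,
`Diag_RequirementPositiveFraction`; class seat abc-iut-rh2-L1, memo `ROUND4/R4-6-DIAG-rh2-L1.md` 1acf23510739163d, reading DT: height `h = s·h(T)` AND level
`l_c(s) ≍ √(s·h)` co-moving as in [IUTchIV] Cor. 2.2 (ii) (C1)/(P1) — the seat's reading, located not adjudicated).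
THE POINT: along the diagonal both the label count and the place integers move with the step, so the price ceiling is NOT height-free — it grows like
`√n·log n` (the seat's closed form) — but it is still SUB-LINEAR against a mass `≥ n·M₁`; the generic face of part 1 extends verbatim to a power ceiling
`Π(n) ≤ A·n^γ` with `0 ≤ γ < 1`: `ExponentAtMost (stepProfile (nettingKept R)) (γ − 1) (2·max(A,0)/M₁)`, exponent `γ − 1 < 0`. The typed Prop takes
`γ = 3/4` (exponent `≤ −1/4` from the hypotheses; `−1 + o(1)` in the seat's closed form).
WHAT IS PROVED (namespace `Summit.ABC.IUTFork.Repair.RH.HeightScalingR4.RayFaces`, continued; [folklore] real arithmetic; 0 `sorry`):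
**`ray_exponentAtMost_of_powerCeiling`** (`n·M₁ ≤ M(n)`, `Π(n) ≤ A·n^γ`, `0 ≤ γ < 1` ⇒ `ExponentAtMost … (γ − 1) (2·max(A,0)/M₁)`), **`ray_negExponent_of_powerCeiling`**,
**`diag_negExponent : Diag_NegExponent`**, **`not_diag_door : ¬ Diag_Door`**, **`diag_requirementPositiveFraction : Diag_RequirementPositiveFraction`**
(`tol(n) ≤ B·√n` against `M(n) ≥ n·M₁` ⇒ from `n ≥ max(1, ⌈(2·max(B,0)/M₁)²⌉)` on the requirement is at least HALF the mass — print's diagonal acts on the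
requirement's sub-leading terms, never on a supply-side class: the regime where a kept fraction `→ 0` cannot close).
HONEST FRAMING: real arithmetic about OUR typed diagonal ray under the class seat's dictionary; the diagonal / its laws are claim-tagged hypotheses of the R4
census, never Literature facts; nothing here asserts that abc is proved or refuted, or takes a side on [IUTchIII] Cor. 3.12 / [IUTchIV] Thm. 1.10 / Cor. 2.2 or on
any author; KILLED-BY-CONSISTENCY (as a door) is a word about OUR profiles; typed ≠ proved (objects); located ≠ adjudicated.
-/

noncomputable section

namespace Summit.ABC.IUTFork.Repair.RH.HeightScalingR4.RayFaces

open Finset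
open Summit.ABC.IUTFork.Repair.RH.HeightScaling Summit.ABC.IUTFork.Repair.RH.HeightScalingR4Classes

variable {ι : Type}

/-- `s ≥ 1 ⇒ s ≤ 2·⌊s⌋₊` (private twin of part 1's helper; `1 ≤ ⌊s⌋₊` is Mathlib's `Nat.one_le_floor_iff`). [folklore] -/
private theorem le_two_mul_natFloor'' {s : ℝ} (hs : 1 ≤ s) : s ≤ 2 * (⌊s⌋₊ : ℝ) := by
  have h1 : (1 : ℝ) ≤ (⌊s⌋₊ : ℝ) := by exact_mod_cast (Nat.one_le_floor_iff s).mpr hs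
  have h2 : s < (⌊s⌋₊ : ℝ) + 1 := Nat.lt_floor_add_one s
  linarith

/-! ## §7. The generic face with a sub-linear POWER ceiling -/

/-- **GENERIC RAY FACE, POWER CEILING**: `n·M₁ ≤ M(n)` (`M₁ > 0`) and `Π(n) ≤ A·n^γ` with `0 ≤ γ < 1` (`n ≥ 1`) give
`ExponentAtMost (stepProfile (nettingKept R)) (γ − 1) (2·max(A,0)/M₁)` — exponent `γ − 1 < 0` (for `γ = 0` this is part 1's `ray_exponentAtMost`). [folklore] -/
theorem ray_exponentAtMost_of_powerCeiling (R : PlaceRay ι) {M₁ A γ : ℝ} (hM₁ : 0 < M₁) (hγ0 : 0 ≤ γ)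
    (hM : ∀ n : ℕ, 1 ≤ n → (n : ℝ) * M₁ ≤ totalDemand R n) (hP : ∀ n : ℕ, 1 ≤ n → totalPrice R n ≤ A * (n : ℝ) ^ γ) :
    ExponentAtMost (stepProfile (nettingKept R)) (γ - 1) (2 * max A 0 / M₁) := by
  intro s hs
  have hn := (Nat.one_le_floor_iff s).mpr hs
  have h2 := le_two_mul_natFloor'' hs
  have hs0 : 0 < s := lt_of_lt_of_le zero_lt_one hs
  have hnpos : (0 : ℝ) < (⌊s⌋₊ : ℝ) := by exact_mod_cast lt_of_lt_of_le Nat.zero_lt_one hn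
  have hnle : (⌊s⌋₊ : ℝ) ≤ s := Nat.floor_le hs0.le
  have hA0 : 0 ≤ max A 0 := le_max_right _ _
  -- at the integer step: kept ≤ max(A·n^γ, 0)/(n·M₁) ≤ max(A,0)·n^γ/(n·M₁)
  have hb := nettingKept_le_div R ⌊s⌋₊ hM₁ hn (hM _ hn) (hP _ hn)
  have hpow0 : 0 ≤ (⌊s⌋₊ : ℝ) ^ γ := Real.rpow_nonneg hnpos.le _
  have hmax : max (A * (⌊s⌋₊ : ℝ) ^ γ) 0 ≤ max A 0 * (⌊s⌋₊ : ℝ) ^ γ :=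
    max_le (mul_le_mul_of_nonneg_right (le_max_left _ _) hpow0) (mul_nonneg hA0 hpow0)
  -- n^γ ≤ s^γ and 1/n ≤ 2/s
  have hpow_le : (⌊s⌋₊ : ℝ) ^ γ ≤ s ^ γ := Real.rpow_le_rpow hnpos.le hnle hγ0
  unfold stepProfile
  have hsplit : s ^ (γ - 1) = s ^ γ / s := Real.rpow_sub_one hs0.ne' γ
  rw [hsplit]
  calc nettingKept R ⌊s⌋₊ ≤ max (A * (⌊s⌋₊ : ℝ) ^ γ) 0 / ((⌊s⌋₊ : ℝ) * M₁) := hb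
    _ ≤ max A 0 * (⌊s⌋₊ : ℝ) ^ γ / ((⌊s⌋₊ : ℝ) * M₁) := div_le_div_of_nonneg_right hmax (by positivity)
    _ ≤ max A 0 * s ^ γ / ((⌊s⌋₊ : ℝ) * M₁) :=
        div_le_div_of_nonneg_right (mul_le_mul_of_nonneg_left hpow_le hA0) (by positivity)
    _ ≤ max A 0 * s ^ γ / (s / 2 * M₁) :=
        div_le_div_of_nonneg_left (mul_nonneg hA0 (Real.rpow_nonneg hs0.le _)) (by positivity) (by nlinarith)
    _ = 2 * max A 0 / M₁ * (s ^ γ / s) := by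
        field_simp

/-- **GENERIC RAY FACE, POWER CEILING ⇒ `Ray_NegExponent`** (`0 ≤ γ < 1`). [folklore] -/
theorem ray_negExponent_of_powerCeiling (R : PlaceRay ι) {M₁ A γ : ℝ} (hM₁ : 0 < M₁) (hγ0 : 0 ≤ γ) (hγ1 : γ < 1)
    (hM : ∀ n : ℕ, 1 ≤ n → (n : ℝ) * M₁ ≤ totalDemand R n) (hP : ∀ n : ℕ, 1 ≤ n → totalPrice R n ≤ A * (n : ℝ) ^ γ) :
    Ray_NegExponent R :=
  ⟨γ - 1, 2 * max A 0 / M₁, by linarith, div_nonneg (mul_nonneg zero_le_two (le_max_right _ _)) hM₁.le,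
    ray_exponentAtMost_of_powerCeiling R hM₁ hγ0 hM hP⟩

/-! ## §8. CLASS (v) DIAGONAL -/

/-- **`Diag_NegExponent` HOLDS** (census row (v): along the height × level diagonal, mass `≥ n·M₁` and price ceiling `≤ A·n^{3/4}` give the netting envelope a
negative exponent — `≤ −1/4` from these hypotheses; the power-ceiling face at `γ = 3/4`). [folklore] -/
theorem diag_negExponent : Diag_NegExponent := by
  intro ι lc W p ev m₁ lnp δlaw routLaw tolLaw M₁ A hM₁ hM hP
  exact ray_negExponent_of_powerCeiling _ hM₁ (by norm_num) (by norm_num) hM hP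

/-- **`Diag_Door` FAILS** (negation of the ∃-form: (v-a) + p532994 `not_doorAt_of_negExponent`). KILLED-BY-CONSISTENCY as a door, kernel face. [folklore] -/
theorem not_diag_door : ¬ Diag_Door := by
  rintro ⟨ι, lc, W, p, ev, m₁, lnp, δlaw, routLaw, tolLaw, M₁, A, hM₁, hM, hP, hdoor⟩
  exact not_doorAt_of_negExponent (diag_negExponent ι lc W p ev m₁ lnp δlaw routLaw tolLaw M₁ A hM₁ hM hP) hdoor

/-- **`Diag_RequirementPositiveFraction` HOLDS** (census row (v), where print's diagonal acts: a tolerance `tol(n) ≤ B·√n` against a mass `≥ n·M₁` leaves the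
requirement `M(n) − tol(n) ≥ M(n)/2` from `n₀ = max(1, ⌈(2·max(B,0)/M₁)²⌉)` on — the requirement stays a fixed positive fraction of the mass, so a kept fraction
`→ 0` cannot close there). [folklore] -/
theorem diag_requirementPositiveFraction : Diag_RequirementPositiveFraction := by
  intro ι lc W p ev m₁ lnp δlaw routLaw tolLaw M₁ B hM₁ hM htol
  set R := diagRay lc W p ev m₁ lnp δlaw routLaw tolLaw with hR
  set c : ℝ := 2 * max B 0 / M₁ with hc
  have hc0 : 0 ≤ c := div_nonneg (mul_nonneg zero_le_two (le_max_right _ _)) hM₁.le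
  refine ⟨max 1 ⌈c ^ 2⌉₊, fun n hn => ?_⟩
  have hn1 : 1 ≤ n := le_trans (le_max_left _ _) hn
  have hnR : (1 : ℝ) ≤ (n : ℝ) := by exact_mod_cast hn1
  have hn0 : (0 : ℝ) ≤ (n : ℝ) := le_trans zero_le_one hnR
  have hceil : c ^ 2 ≤ (n : ℝ) := (Nat.le_ceil _).trans (by exact_mod_cast le_trans (le_max_right _ _) hn)
  -- √n ≥ c, hence max(B,0)·√n ≤ (M₁/2)·n
  have hsqrt : c ≤ Real.sqrt n := (Real.le_sqrt hc0 hn0).mpr hceil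
  have hss : Real.sqrt n * Real.sqrt n = n := Real.mul_self_sqrt hn0
  have hsq0 : 0 ≤ Real.sqrt n := Real.sqrt_nonneg _
  have htol' : tolLaw n ≤ max B 0 * Real.sqrt n :=
    (htol n hn1).trans (mul_le_mul_of_nonneg_right (le_max_left _ _) hsq0)
  have hkey : max B 0 * Real.sqrt n ≤ M₁ / 2 * n := by
    have h1 : max B 0 ≤ M₁ / 2 * c := by rw [hc]; field_simp; linarith [le_max_right B 0]
    have h2 : max B 0 ≤ M₁ / 2 * Real.sqrt n := h1.trans (mul_le_mul_of_nonneg_left hsqrt (by linarith))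
    calc max B 0 * Real.sqrt n ≤ M₁ / 2 * Real.sqrt n * Real.sqrt n := mul_le_mul_of_nonneg_right h2 hsq0
      _ = M₁ / 2 * n := by rw [mul_assoc, hss]
  have hMn := hM n hn1
  have htolR : R.tol n = tolLaw n := rfl
  unfold HeightScalingR4Classes.requirement
  rw [htolR]
  linarith

end Summit.ABC.IUTFork.Repair.RH.HeightScalingR4.RayFaces

end
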